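import Summits.ValiantsHypothesis.ValiantsHypothesis.Theorems.BarrierLeverPartitionMinorsGenericChowProduct

/-!
# Route BarrierLever — Chow witnesses for partition minors (items 20172 / 20195): the COORDINATE
# LIFT (adding one `x`-coordinate and one `y`-coordinate)

Helper file (`--supports stmt-ValiantsHypothesis-20195`; cell valiant-natproofs, rung V4, 𝒟-side of
door (c); seat val-np-p4 gen 10).  Closes NO item; imports only `…PartitionMinorsGenericChowProduct`
(Mathlib/Literature-level).

Items 20172 / 20195 quantify over ALL heights `h ≥ h₀`; the elementary reduction in `h` is the lift of
a height-`h` situation into height `h + 1` along the embeddings `a.succAbove` of the `x`-coordinates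
and `c.succAbove` of the `y`-coordinates (row coordinate `a` and column coordinate `c` are the NEW
ones).  On variables this is the map
`L : Fin (h+h) → Fin ((h+1)+(h+1))`, `castAdd b ↦ castAdd (a.succAbove b)`, `natAdd d ↦ natAdd (c.succAbove d)`
(written with `Fin.append`).  This file proves:

* `lift_injective`, `lift_apply_castAdd/natAdd`;
* `mapDomain_lift_partitionExpo` — `L` carries the exponent `E U W` to `E (U.map a.succAboveEmb) (W.map c.succAboveEmb)`;
* `coeff_lift_rename` — so `coeff (E U↑ W↑) (rename L P) = coeff (E U W) P`;
* `support_rename_lift` — `rename L P` involves neither `x_a` nor `y_c`;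
* `erase_eq_map_preimage_succAbove` — a face `S` of height `h+1` with `a` erased is the lift of its
  preimage under `a.succAbove`;
* `chow_hit_lift` — **if a layout `(U, W)` of height `h` is hit by a product of `h + h` affine forms,
  its lift `(U.map a.succAboveEmb, W.map c.succAboveEmb)` is hit by a product of `(h+1)+(h+1)` affine
  forms** (the renamed forms and two constant forms `1`).

Together with `…DisjointVariables` (`coeff_partitionExpo_mul_pairFactor`) and
`…GenericChowProduct` (`exists_common_chow_witness`) this is the bookkeeping of a literal-pair split
for Chow witnesses (not assembled here).

WHAT THIS IS NOT: bookkeeping; nothing on items 20195 / 20172 / 19717 themselves, on crux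
stmt-ValiantsHypothesis-14610, or on `VP` versus `VNP`.
-/

set_option linter.dupNamespace false

namespace Summit.ValiantsHypothesis.ValiantsHypothesis.Theorems.BarrierLever.ChowFactor

open Finset MvPolynomial
open Summit.ValiantsHypothesis.ValiantsHypothesis.Theorems.BarrierLever.ProductStateSums
  (castAdd_ne_natAdd partitionExpo_apply_castAdd partitionExpo_apply_natAdd)

noncomputable section

variable {h : ℕ}

/-! ## 1. The lift of variables -/

/-- The lift on an `x`-variable. -/
theorem lift_apply_castAdd (a c : Fin (h + 1)) (b : Fin h) :
    Fin.append (fun b : Fin h => Fin.castAdd (h + 1) (a.succAbove b))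
        (fun d : Fin h => Fin.natAdd (h + 1) (c.succAbove d)) (Fin.castAdd h b) =
      Fin.castAdd (h + 1) (a.succAbove b) :=
  Fin.append_left _ _ b

/-- The lift on a `y`-variable. -/
theorem lift_apply_natAdd (a c : Fin (h + 1)) (d : Fin h) :
    Fin.append (fun b : Fin h => Fin.castAdd (h + 1) (a.succAbove b))
        (fun d : Fin h => Fin.natAdd (h + 1) (c.succAbove d)) (Fin.natAdd h d) =
      Fin.natAdd (h + 1) (c.succAbove d) :=
  Fin.append_right _ _ d

/-- The lift of variables is injective. -/
theorem lift_injective (a c : Fin (h + 1)) :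
    Function.Injective (Fin.append (fun b : Fin h => Fin.castAdd (h + 1) (a.succAbove b))
      (fun d : Fin h => Fin.natAdd (h + 1) (c.succAbove d))) := by
  intro v v' hv
  induction v using Fin.addCases with
  | left b =>
    induction v' using Fin.addCases with
    | left b' =>
      rw [lift_apply_castAdd, lift_apply_castAdd] at hv
      rw [Fin.succAbove_right_injective (Fin.castAdd_injective _ _ hv)]
    | right d' =>
      rw [lift_apply_castAdd, lift_apply_natAdd] at hv
      exact absurd hv (castAdd_ne_natAdd _ _)
  | right d =>
    induction v' using Fin.addCases with
    | left b' =>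
      rw [lift_apply_natAdd, lift_apply_castAdd] at hv
      exact absurd hv.symm (castAdd_ne_natAdd _ _)
    | right d' =>
      rw [lift_apply_natAdd, lift_apply_natAdd] at hv
      rw [Fin.succAbove_right_injective (Fin.natAdd_injective _ _ hv)]

/-- Neither `x_a` nor `y_c` is in the range of the lift. -/
theorem not_mem_range_lift (a c : Fin (h + 1)) (v : Fin ((h + 1) + (h + 1)))
    (hv : v = Fin.castAdd (h + 1) a ∨ v = Fin.natAdd (h + 1) c) :
    v ∉ Set.range (Fin.append (fun b : Fin h => Fin.castAdd (h + 1) (a.succAbove b))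
      (fun d : Fin h => Fin.natAdd (h + 1) (c.succAbove d))) := by
  rintro ⟨v', hv'⟩
  induction v' using Fin.addCases with
  | left b =>
    rw [lift_apply_castAdd] at hv'
    rcases hv with rfl | rfl
    · exact Fin.succAbove_ne a b (Fin.castAdd_injective _ _ hv')
    · exact castAdd_ne_natAdd _ _ hv'
  | right d =>
    rw [lift_apply_natAdd] at hv'
    rcases hv with rfl | rfl
    · exact castAdd_ne_natAdd _ _ hv'.symm
    · exact Fin.succAbove_ne c d (Fin.natAdd_injective _ _ hv')

/-! ## 2. Exponents, coefficients and supports under the lift -/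

/-- **The lift carries `E U W` to `E U↑ W↑`.** -/
theorem mapDomain_lift_partitionExpo (a c : Fin (h + 1)) (U W : Finset (Fin h)) :
    Finsupp.mapDomain (Fin.append (fun b : Fin h => Fin.castAdd (h + 1) (a.succAbove b))
        (fun d : Fin h => Fin.natAdd (h + 1) (c.succAbove d)))
      (∑ b ∈ U, Finsupp.single (Fin.castAdd h b) 1 + ∑ d ∈ W, Finsupp.single (Fin.natAdd h d) 1 :
        Fin (h + h) →₀ ℕ) =
      ∑ a' ∈ U.map (Fin.succAboveEmb a), Finsupp.single (Fin.castAdd (h + 1) a') 1 +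
        ∑ c' ∈ W.map (Fin.succAboveEmb c), Finsupp.single (Fin.natAdd (h + 1) c') 1 := by
  rw [Finsupp.mapDomain_add, Finsupp.mapDomain_finsetSum, Finsupp.mapDomain_finsetSum,
    Finset.sum_map, Finset.sum_map]
  congr 1
  · refine Finset.sum_congr rfl fun b _ => ?_
    rw [Finsupp.mapDomain_single, lift_apply_castAdd]
    rfl
  · refine Finset.sum_congr rfl fun d _ => ?_
    rw [Finsupp.mapDomain_single, lift_apply_natAdd]
    rfl

/-- **Coefficients under the lift**: `coeff (E U↑ W↑) (rename L P) = coeff (E U W) P`. -/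
theorem coeff_lift_rename {R : Type*} [CommSemiring R] (a c : Fin (h + 1)) (U W : Finset (Fin h))
    (P : MvPolynomial (Fin (h + h)) R) :
    coeff (∑ a' ∈ U.map (Fin.succAboveEmb a), Finsupp.single (Fin.castAdd (h + 1) a') 1 +
        ∑ c' ∈ W.map (Fin.succAboveEmb c), Finsupp.single (Fin.natAdd (h + 1) c') 1)
      (rename (Fin.append (fun b : Fin h => Fin.castAdd (h + 1) (a.succAbove b))
        (fun d : Fin h => Fin.natAdd (h + 1) (c.succAbove d))) P) =
      coeff (∑ b ∈ U, Finsupp.single (Fin.castAdd h b) 1 + ∑ d ∈ W, Finsupp.single (Fin.natAdd h d) 1)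
        P := by
  rw [← mapDomain_lift_partitionExpo, coeff_rename_mapDomain _ (lift_injective a c)]

/-- **A lifted polynomial involves neither `x_a` nor `y_c`.** -/
theorem support_rename_lift {R : Type*} [CommSemiring R] (a c : Fin (h + 1))
    (P : MvPolynomial (Fin (h + h)) R) :
    ∀ m ∈ (rename (Fin.append (fun b : Fin h => Fin.castAdd (h + 1) (a.succAbove b))
        (fun d : Fin h => Fin.natAdd (h + 1) (c.succAbove d))) P).support,
      ∀ v, (v = Fin.castAdd (h + 1) a ∨ v = Fin.natAdd (h + 1) c) → m v = 0 := by
  classical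
  intro m hm v hv
  rw [support_rename_of_injective (lift_injective a c)] at hm
  obtain ⟨m', -, rfl⟩ := Finset.mem_image.mp hm
  exact Finsupp.mapDomain_notin_range _ _ (not_mem_range_lift a c v hv)

/-! ## 3. Faces -/

/-- **A face with the new coordinate erased is the lift of its preimage.** -/
theorem erase_eq_map_preimage_succAbove (a : Fin (h + 1)) (S : Finset (Fin (h + 1))) :
    S.erase a = (S.preimage a.succAbove (Fin.succAbove_right_injective.injOn)).map
      (Fin.succAboveEmb a) := by
  classical
  ext x
  rw [Finset.mem_erase, Finset.mem_map]
  constructor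
  · rintro ⟨hxa, hx⟩
    obtain ⟨z, hz⟩ := Fin.exists_succAbove_eq hxa
    refine ⟨z, ?_, hz⟩
    rw [Finset.mem_preimage, hz]
    exact hx
  · rintro ⟨z, hz, rfl⟩
    rw [Finset.mem_preimage] at hz
    exact ⟨Fin.succAbove_ne a z, hz⟩

/-- A face avoiding the new coordinate is the lift of its preimage. -/
theorem eq_map_preimage_succAbove_of_not_mem (a : Fin (h + 1)) (S : Finset (Fin (h + 1)))
    (ha : a ∉ S) :
    S = (S.preimage a.succAbove (Fin.succAbove_right_injective.injOn)).map
      (Fin.succAboveEmb a) := by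
  rw [← erase_eq_map_preimage_succAbove, Finset.erase_eq_of_notMem ha]

/-! ## 4. Lifting a Chow witness -/

/-- Renaming keeps affine forms affine. -/
theorem totalDegree_rename_le_one {R : Type*} [CommSemiring R] {σ τ : Type*} (f : σ → τ)
    (ℓ : MvPolynomial σ R) (hℓ : ℓ.totalDegree ≤ 1) : (rename f ℓ).totalDegree ≤ 1 :=
  (totalDegree_rename_le f ℓ).trans hℓ

/-- **Lifting a Chow witness one height up.**  If the layout `(U, W)` of height `h` is hit by a
product of `h + h` affine forms, then the lifted layout `(U.map a.succAboveEmb, W.map c.succAboveEmb)`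
of height `h + 1` is hit by a product of `(h+1) + (h+1)` affine forms (the renamed forms, followed by
two constant forms `1`). -/
theorem chow_hit_lift (a c : Fin (h + 1)) {r : ℕ} (U W : Fin r → Finset (Fin h))
    (hhit : ∃ ℓ : Fin (h + h) → MvPolynomial (Fin (h + h)) ℂ, (∀ k, (ℓ k).totalDegree ≤ 1) ∧
      (Matrix.of fun i j : Fin r => coeff
        (∑ b ∈ U i, Finsupp.single (Fin.castAdd h b) 1 + ∑ d ∈ W j, Finsupp.single (Fin.natAdd h d) 1)
        (∏ k, ℓ k)).det ≠ 0) :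
    ∃ ℓ : Fin ((h + 1) + (h + 1)) → MvPolynomial (Fin ((h + 1) + (h + 1))) ℂ,
      (∀ k, (ℓ k).totalDegree ≤ 1) ∧
      (Matrix.of fun i j : Fin r => coeff
        (∑ a' ∈ (U i).map (Fin.succAboveEmb a), Finsupp.single (Fin.castAdd (h + 1) a') 1 +
          ∑ c' ∈ (W j).map (Fin.succAboveEmb c), Finsupp.single (Fin.natAdd (h + 1) c') 1)
        (∏ k, ℓ k)).det ≠ 0 := by
  classical
  obtain ⟨ℓ, hdeg, hdet⟩ := hhit
  -- the variable lift and the index equivalence `Fin ((h+h)+2) ≃ Fin ((h+1)+(h+1))`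
  set L : Fin (h + h) → Fin ((h + 1) + (h + 1)) := Fin.append
    (fun b : Fin h => Fin.castAdd (h + 1) (a.succAbove b))
    (fun d : Fin h => Fin.natAdd (h + 1) (c.succAbove d)) with hL
  have hcard : (h + h) + 2 = (h + 1) + (h + 1) := by omega
  set e : Fin ((h + h) + 2) ≃ Fin ((h + 1) + (h + 1)) := finCongr hcard with he
  -- the lifted forms: renamed old forms, then two constant forms
  set ℓ' : Fin ((h + h) + 2) → MvPolynomial (Fin ((h + 1) + (h + 1))) ℂ :=
    Fin.append (fun k => rename L (ℓ k)) (fun _ => 1) with hℓ'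
  refine ⟨fun k => ℓ' (e.symm k), fun k => ?_, ?_⟩
  · -- degrees
    show (ℓ' (e.symm k)).totalDegree ≤ 1
    generalize e.symm k = k₀
    rw [hℓ']
    induction k₀ using Fin.addCases with
    | left k' =>
      rw [Fin.append_left]
      exact totalDegree_rename_le_one L (ℓ k') (hdeg k')
    | right k' =>
      rw [Fin.append_right, totalDegree_one]
      exact Nat.zero_le _
  · -- the product is the renamed product
    have hprod : (∏ k, ℓ' (e.symm k)) = rename L (∏ k, ℓ k) := by
      rw [Fintype.prod_equiv e.symm (fun k => ℓ' (e.symm k)) ℓ' (fun _ => rfl), hℓ',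
        Fin.prod_univ_add]
      simp only [Fin.append_left, Fin.append_right, Finset.prod_const_one, mul_one]
      rw [map_prod]
    rw [hprod]
    have hM : (Matrix.of fun i j : Fin r => coeff
        (∑ a' ∈ (U i).map (Fin.succAboveEmb a), Finsupp.single (Fin.castAdd (h + 1) a') 1 +
          ∑ c' ∈ (W j).map (Fin.succAboveEmb c), Finsupp.single (Fin.natAdd (h + 1) c') 1)
        (rename L (∏ k, ℓ k))) =
        Matrix.of fun i j : Fin r => coeff
          (∑ b ∈ U i, Finsupp.single (Fin.castAdd h b) 1 + ∑ d ∈ W j, Finsupp.single (Fin.natAdd h d) 1)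
          (∏ k, ℓ k) := by
      ext i j
      rw [Matrix.of_apply, Matrix.of_apply, hL, coeff_lift_rename]
    rw [hM]
    exact hdet

end

end Summit.ValiantsHypothesis.ValiantsHypothesis.Theorems.BarrierLever.ChowFactor
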